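import Summits.QuantumAdvantage.QuantumAdvantage.Theorems.CubicForrelationNearExactIsExactTwoModSixPrep

/-!
# Crux `CubicForrelation.NearExactIsExact` (stmt-QuantumAdvantage-14043) — `n = 6r+2`: the tower ABOVE level `2r+4` at the second boundary
  (`W_g ∈ 2^{2r+5}ℤ ∧ Φ ≥ 1 − 2^{−2r} ⇒ Φ = 1`, `r ≥ 4`) — one-sided

Certificate seat `b2b-cforr-cert` (gen 9).  HONEST FRAMING: a theorem uniform in `r` about cubic Boolean pairs on `6r+2` bits (the one-sided part of
the level analysis at the SECOND dyadic boundary `1 − 2^{−⌊n/3⌋}` on `n ≡ 2 (mod 6)`, `n ≥ 26`); NOT summit progress.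

`tm2_second_high_levels` (`r ≥ 4`): if `W_g ∈ 2^{2r+5}ℤ` and `Φ ≥ 1 − 2^{−2r}` then `Φ = 1` — the tower walk `tms_walk_from` from level `2r+5`
with cost exponent `2r−1` (every level `2r+5 ≤ j < 3r+1` costs `≥ 2^{−(2r−1)}`: exponents `(3j−n)/2 + 1 + 2(m−j) ≤ 2r−1`; top level
`⌊(3r+1)/2⌋ + 1 ≤ 2r−1` for `r ≥ 4`), and a bent `g` gives `Φ = 1` or `Φ ≤ 1 − 2^{1−⌊(3r+4)/2⌋} < 1 − 2^{−2r}` (`r ≥ 3`).  The two levels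
`2r+3`, `2r+4` below it are tight two-sided configurations (codimension-3 and -5 flats; `…TwoModSixSecondLevelThree` and a sequel); at
`r = 3` (`n = 20`) the top level `10 = 2r+4` is itself two-sided.

References: J. Ax (1964) / R. J. McEliece (1972); X.-D. Hou (1998); MacWilliams–Sloane (1977) Ch. 13–15.  Everything below is proved from Mathlib
and the tree; axioms are the standard three.
-/

set_option linter.dupNamespace false -- D-0017: single-problem summit ⇒ `QuantumAdvantage.QuantumAdvantage` by design

noncomputable section

namespace Summit.QuantumAdvantage.QuantumAdvantage.Theorems.CubicForrelation.NearExactIsExact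

open Finset
open Literature.Computability.QuantumComplexity
open Literature.Computability.QuantumComplexity.DerivativeWalsh (W)

/-- **The levels `≥ 2r+5` on `6r+2` bits at the second boundary (`r ≥ 4`).**  If `W_g ∈ 2^{2r+5}ℤ` and `Φ(f,g) ≥ 1 − 2^{−2r}` then
`Φ(f,g) = 1`.  Uniform in `r`; one-sided (capacity + Hou); NOT summit progress. [this work] -/
theorem tm2_second_high_levels (r : ℕ) (hr : 4 ≤ r) (f g : (Fin ((3 * r + 1) + (3 * r + 1)) → Bool) → Bool) (hf : IsDegLeFun 3 f)
    (hg : IsDegLeFun 3 g) (w : (Fin ((3 * r + 1) + (3 * r + 1)) → Bool) → ℤ)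
    (hw : ∀ x, W (fun y => signOf (g y)) x = (2 : ℝ) ^ (2 * r + 5) * (w x : ℝ))
    (hΦ : 1 - (1 / 2 : ℝ) ^ (2 * r) ≤ forrelation f g) : forrelation f g = 1 := by
  obtain ⟨k, rfl⟩ : ∃ k, r = k + 4 := ⟨r - 4, by omega⟩
  rcases tms_walk_from (3 * (k + 4) + 1) (2 * (k + 4) + 5) (2 * (k + 4) - 1) g hg (by omega) (by omega) w hw
    (by intro j hj hjm; omega) (by omega) with hbent | hcap
  · rcases tw_bent_end (by omega) f g hf hg hbent with h | h
    · exact h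
    · exfalso
      have hlt : (1 / 2 : ℝ) ^ (2 * (k + 4)) < 2 / 2 ^ ((3 * (k + 4) + 1 + 3) / 2) := by
        have e : (2 : ℝ) / 2 ^ ((3 * (k + 4) + 1 + 3) / 2) = (1 / 2) ^ ((3 * (k + 4) + 1 + 3) / 2 - 1) := by
          obtain ⟨a, ha⟩ : ∃ a, (3 * (k + 4) + 1 + 3) / 2 = a + 1 := ⟨(3 * (k + 4) + 1 + 3) / 2 - 1, by omega⟩
          rw [ha, pow_succ, one_div_pow, Nat.add_sub_cancel]
          field_simp
        rw [e]
        exact pow_lt_pow_right_of_lt_one₀ (by norm_num) (by norm_num) (by omega)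
      linarith
  · exfalso
    have := tw_forrelation_le_of_cap f g hcap
    have hlt : (1 / 2 : ℝ) ^ (2 * (k + 4)) < (1 / 2) ^ (2 * (k + 4) - 1) :=
      pow_lt_pow_right_of_lt_one₀ (by norm_num) (by norm_num) (by omega)
    linarith

end Summit.QuantumAdvantage.QuantumAdvantage.Theorems.CubicForrelation.NearExactIsExact

end
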